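import Summits.CriticalPhenomena.PercolationContinuityZ3.Theorems.PercNearOneGluingNoHeavyLowerTailTwoPortPeelingCPortAssembly
import Summits.CriticalPhenomena.PercolationContinuityZ3.Theorems.PercNearOneGluingNoHeavyLowerTailTwoPortPeeling
import Summits.CriticalPhenomena.PercolationContinuityZ3.Theorems.PercNearOneGluingNoHeavyLowerTailTwoPortPeelingSurePairs
import HarnessLib

/-!
# `NoHeavyLowerTail` (stmt-CriticalPhenomena-4575) — two-port peeling, champion at a port: reduction and the level-2 theorem

Route `PercNearOneGluingNoHeavy`, seat `prim-gen-swap` (gen 5); memo TWO-PORT-PEELING.md §9 (R).  For `u = {c, a'}` with the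
champion `c` a port of `u` and `v = {b, b'}` a two-port star: peel at `v` (`championStabilityPair_twoPort_of_mixed`), slice at
`u` over its two bonds (`real_twoBond`); in the worlds where `uc` is open the CS₂ pair events are null and the observer events of
`c` and `u` coincide, so CS₂ reduces to `0 ≤ (1 − a_c a')·E[Z]` (`championStabilityPair_cport_of_Z`), which is
`cport_nonneg_levelTwo`; hence CS₂ for merging `u` and `v` holds unconditionally at `j ≤ 2`
(`championStabilityPair_cport_levelTwo`).  No definitions, no named facts, no sorries.
-/

noncomputable section

namespace Summit.CriticalPhenomena.PercolationContinuityZ3.Theorems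

open MeasureTheory Set Literature.Probability.LatticeModels Literature.Probability.Percolation
open scoped Classical BigOperators

variable {n : ℕ}

namespace TwoPortPeeling

/-- With the pair `uc` surely open, the observer events of the hub `u` and of its port `c` have equal probability:
`P(1 ≤ N_u ≤ j) = P(c lonely)` (`c ∈ A`). [this file] -/
theorem real_small_hub_eq_lonely_port (W : Sym2 (Fin n) → unitInterval) (A : Finset (Fin n)) {u c : Fin n} (j : ℕ)
    (hc : c ∈ A) (hcu : c ≠ u) (hW : W s(u, c) = 1) :
    (prodBernoulli W).real {ω : BondConfig (Fin n) | 1 ≤ (A.filter fun z => ω ∈ openConn u z).card ∧ (A.filter fun z => ω ∈ openConn u z).card ≤ j} =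
      (prodBernoulli W).real {ω : BondConfig (Fin n) | (A.filter fun z => ω ∈ openConn c z).card ≤ j} := by
  have hWW : W = Function.update (Function.update W s(u, c) 0) s(u, c) 1 := by
    rw [Function.update_idem, ← hW, Function.update_eq_self]
  rw [hWW, relay_lonely_eq_small A c j hc]
  exact glued_real_count_eq (Function.update W s(u, c) 0) A u c (fun m => 1 ≤ m ∧ m ≤ j) hcu (Function.update_self _ _ _)

/-- With the pair `uc` surely open, an event requiring `c ∉ π(u)` is null. [this file] -/
theorem real_notConn_port_eq_zero (W : Sym2 (Fin n) → unitInterval) {u c : Fin n} (hcu : c ≠ u) (hW : W s(u, c) = 1)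
    (S : Set (BondConfig (Fin n))) (hS : S ⊆ {ω : BondConfig (Fin n) | ω ∉ openConn c u}) :
    (prodBernoulli W).real S = 0 := by
  have h0 := real_notMem_eq_zero_of_one W (s(u, c)) hW
  have hsub : S ⊆ {ω : BondConfig (Fin n) | s(u, c) ∉ ω} := by
    intro ω hω hmem
    have hmem' : s(c, u) ∈ ω := by rw [Sym2.eq_swap]; exact hmem
    exact hS hω (((openGraph_adj ω c u).2 ⟨hmem', hcu⟩).reachable)
  exact le_antisymm ((measureReal_mono hsub).trans (le_of_eq h0)) measureReal_nonneg

/-- **Reduction (champion at a port).**  CS₂ for merging the two-port stars `u = {c, a'}` and `v = {b, b'}` with champion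
`c` follows from `0 ≤ (1 − a_c a')·[(1 − a')·h00 + a'·h01]` (the measure form of `E[Z] ≥ 0`, memo §9). [this file] -/
theorem championStabilityPair_cport_of_Z (w : Sym2 (Fin n) → unitInterval) (A : Finset (Fin n))
    (u v c a' b b' : Fin n) (j : ℕ) (hu : u ∉ A) (hv : v ∉ A) (huv : u ≠ v)
    (hc : c ∈ A) (ha' : a' ∈ A) (hb : b ∈ A) (hb' : b' ∈ A)
    (hca' : c ≠ a') (hbb' : b ≠ b')
    (hvtwo : ∀ y : Fin n, y ≠ v → y ≠ b → y ≠ b' → w s(v, y) = 0)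
    (hchamp : ∀ x ∈ A,
      (prodBernoulli w).real {ω : BondConfig (Fin n) | (A.filter fun z => ω ∈ openConn x z).card ≤ j} ≤
        (prodBernoulli w).real {ω : BondConfig (Fin n) | (A.filter fun z => ω ∈ openConn c z).card ≤ j})
    (hZ : 0 ≤ (1 - ((w s(u, c) : ℝ) * (w s(u, a') : ℝ))) * ((1 - (w s(u, a') : ℝ)) * ((1 - ((w s(v, b) : ℝ) * w s(v, b'))) * ((prodBernoulli (Function.update (Function.update (Function.update (Function.update w s(v, b) 0) s(v, b') 0) s(u, c) 0) s(u, a') 0)).real {ω : BondConfig (Fin n) | (A.filter fun z => ω ∈ openConn c z).card ≤ j} - (prodBernoulli (Function.update (Function.update (Function.update (Function.update w s(v, b) 0) s(v, b') 0) s(u, c) 0) s(u, a') 0)).real {ω : BondConfig (Fin n) | 1 ≤ (A.filter fun z => ω ∈ openConn u z).card ∧ (A.filter fun z => ω ∈ openConn u z).card ≤ j}) + ((w s(v, b) : ℝ) * w s(v, b')) * ((prodBernoulli (Function.update (Function.update (Function.update (Function.update w s(v, b) 1) s(v, b') 1) s(u, c) 0) s(u, a') 0)).real {ω : BondConfig (Fin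 n) | ω ∉ openConn c u ∧ ω ∉ openConn c v ∧ (A.filter fun z => ω ∈ openConn c z).card ≤ j} - (prodBernoulli (Function.update (Function.update (Function.update (Function.update w s(v, b) 1) s(v, b') 1) s(u, c) 0) s(u, a') 0)).real {ω : BondConfig (Fin n) | ω ∉ openConn c u ∧ ω ∉ openConn c v ∧ 1 ≤ (A.filter fun z => ω ∈ openConn u z ∨ ω ∈ openConn v z).card ∧ (A.filter fun z => ω ∈ openConn u z ∨ ω ∈ openConn v z).card ≤ j})) +
      (w s(u, a') : ℝ) * ((1 - ((w s(v, b) : ℝ) * w s(v, b'))) * ((prodBernoulli (Function.update (Function.update (Function.update (Function.update w s(v, b) 0) s(v, b') 0) s(u, c) 0) s(u, a') 1)).real {ω : BondConfig (Fin n) | (A.filter fun z => ω ∈ openConn c z).card ≤ j} - (prodBernoulli (Function.update (Function.update (Function.update (Function.update w s(v, b) 0) s(v, b') 0) s(u, c) 0) s(u, a') 1)).real {ω : BondConfig (Fin n) | 1 ≤ (A.filter fun z => ω ∈ openConn u z).card ∧ (A.filter fun z => ω ∈ openConn u z).card ≤ j}) + ((w s(v, b) : ℝ) * w s(v, b'))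 * ((prodBernoulli (Function.update (Function.update (Function.update (Function.update w s(v, b) 1) s(v, b') 1) s(u, c) 0) s(u, a') 1)).real {ω : BondConfig (Fin n) | ω ∉ openConn c u ∧ ω ∉ openConn c v ∧ (A.filter fun z => ω ∈ openConn c z).card ≤ j} - (prodBernoulli (Function.update (Function.update (Function.update (Function.update w s(v, b) 1) s(v, b') 1) s(u, c) 0) s(u, a') 1)).real {ω : BondConfig (Fin n) | ω ∉ openConn c u ∧ ω ∉ openConn c v ∧ 1 ≤ (A.filter fun z => ω ∈ openConn u z ∨ ω ∈ openConn v z).card ∧ (A.filter fun z => ω ∈ openConn u z ∨ ω ∈ openConn v z).card ≤ j})))) :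
    (prodBernoulli w).real {ω : BondConfig (Fin n) | ω ∉ openConn c u ∧ ω ∉ openConn c v ∧ 1 ≤ (A.filter fun z => ω ∈ openConn u z ∨ ω ∈ openConn v z).card ∧ (A.filter fun z => ω ∈ openConn u z ∨ ω ∈ openConn v z).card ≤ j} ≤
      (prodBernoulli w).real {ω : BondConfig (Fin n) | ω ∉ openConn c u ∧ ω ∉ openConn c v ∧ (A.filter fun z => ω ∈ openConn c z).card ≤ j} := by
  have huc : u ≠ c := fun h => hu (h ▸ hc)
  have hua' : u ≠ a' := fun h => hu (h ▸ ha')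
  have hub : u ≠ b := fun h => hu (h ▸ hb)
  have hub' : u ≠ b' := fun h => hu (h ▸ hb')
  have png : ∀ {p q r t : Fin n}, (p ≠ r ∨ q ≠ t) → (p ≠ t ∨ q ≠ r) → (s(p, q) : Sym2 (Fin n)) ≠ s(r, t) := by
    intro p q r t h1 h2 h
    rw [Sym2.eq_iff] at h
    rcases h with ⟨h3, h4⟩ | ⟨h3, h4⟩
    · rcases h1 with h1 | h1
      · exact h1 h3
      · exact h1 h4
    · rcases h2 with h2 | h2
      · exact h2 h3
      · exact h2 h4
  have nUA : (s(u, c) : Sym2 (Fin n)) ≠ s(u, a') := png (Or.inr hca') (Or.inl hua')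
  have nAB : (s(u, c) : Sym2 (Fin n)) ≠ s(v, b) := png (Or.inl huv) (Or.inl hub)
  have nAB' : (s(u, c) : Sym2 (Fin n)) ≠ s(v, b') := png (Or.inl huv) (Or.inl hub')
  have nA'B : (s(u, a') : Sym2 (Fin n)) ≠ s(v, b) := png (Or.inl huv) (Or.inl hub)
  have nA'B' : (s(u, a') : Sym2 (Fin n)) ≠ s(v, b') := png (Or.inl huv) (Or.inl hub')
  have hp0 : 0 ≤ (w s(u, c) : ℝ) := (w s(u, c)).2.1
  have hp1 : (w s(u, c) : ℝ) ≤ 1 := (w s(u, c)).2.2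
  have hq0 : 0 ≤ (w s(u, a') : ℝ) := (w s(u, a')).2.1
  have hq1 : (w s(u, a') : ℝ) ≤ 1 := (w s(u, a')).2.2
  refine championStabilityPair_twoPort_of_mixed w A u v b b' c j hv hb hb' hbb' hc hvtwo hchamp ?_
  have hV0c : ((Function.update (Function.update w s(v, b) 0) s(v, b') 0) s(u, c) : ℝ) = w s(u, c) := by rw [Function.update_of_ne nAB', Function.update_of_ne nAB]
  have hV0a' : ((Function.update (Function.update w s(v, b) 0) s(v, b') 0) s(u, a') : ℝ) = w s(u, a') := by rw [Function.update_of_ne nA'B', Function.update_of_ne nA'B]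
  have hV1c : ((Function.update (Function.update w s(v, b) 1) s(v, b') 1) s(u, c) : ℝ) = w s(u, c) := by rw [Function.update_of_ne nAB', Function.update_of_ne nAB]
  have hV1a' : ((Function.update (Function.update w s(v, b) 1) s(v, b') 1) s(u, a') : ℝ) = w s(u, a') := by rw [Function.update_of_ne nA'B', Function.update_of_ne nA'B]
  rw [real_twoBond (Function.update (Function.update w s(v, b) 0) s(v, b') 0) nUA {ω : BondConfig (Fin n) | (A.filter fun z => ω ∈ openConn c z).card ≤ j},
    real_twoBond (Function.update (Function.update w s(v, b) 0) s(v, b') 0) nUA {ω : BondConfig (Fin n) | 1 ≤ (A.filter fun z => ω ∈ openConn u z).card ∧ (A.filter fun z => ω ∈ openConn u z).card ≤ j},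
    real_twoBond (Function.update (Function.update w s(v, b) 1) s(v, b') 1) nUA {ω : BondConfig (Fin n) | ω ∉ openConn c u ∧ ω ∉ openConn c v ∧ (A.filter fun z => ω ∈ openConn c z).card ≤ j},
    real_twoBond (Function.update (Function.update w s(v, b) 1) s(v, b') 1) nUA {ω : BondConfig (Fin n) | ω ∉ openConn c u ∧ ω ∉ openConn c v ∧ 1 ≤ (A.filter fun z => ω ∈ openConn u z ∨ ω ∈ openConn v z).card ∧ (A.filter fun z => ω ∈ openConn u z ∨ ω ∈ openConn v z).card ≤ j},
    hV0c, hV0a', hV1c, hV1a']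
  -- worlds with `uc` open: observer events of `u` and `c` agree, pair events vanish
  have hX10 : (Function.update (Function.update (Function.update (Function.update w s(v, b) 0) s(v, b') 0) s(u, c) 1) s(u, a') 0) = Function.update (Function.update (Function.update (Function.update w s(v, b) 0) s(v, b') 0) s(u, a') 0) s(u, c) 1 := Function.update_comm nUA _ _ _
  have hX11 : (Function.update (Function.update (Function.update (Function.update w s(v, b) 0) s(v, b') 0) s(u, c) 1) s(u, a') 1) = Function.update (Function.update (Function.update (Function.update w s(v, b) 0) s(v, b') 0) s(u, a') 1) s(u, c) 1 := Function.update_comm nUA _ _ _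
  have one10 : (Function.update (Function.update (Function.update (Function.update w s(v, b) 0) s(v, b') 0) s(u, c) 1) s(u, a') 0) s(u, c) = 1 := by rw [hX10, Function.update_self]
  have one11 : (Function.update (Function.update (Function.update (Function.update w s(v, b) 0) s(v, b') 0) s(u, c) 1) s(u, a') 1) s(u, c) = 1 := by rw [hX11, Function.update_self]
  have one10' : (Function.update (Function.update (Function.update (Function.update w s(v, b) 1) s(v, b') 1) s(u, c) 1) s(u, a') 0) s(u, c) = 1 := by rw [Function.update_of_ne nUA, Function.update_self]
  have one11' : (Function.update (Function.update (Function.update (Function.update w s(v, b) 1) s(v, b') 1) s(u, c) 1) s(u, a') 1) s(u, c) = 1 := by rw [Function.update_of_ne nUA, Function.update_self]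
  have l10 := real_small_hub_eq_lonely_port (Function.update (Function.update (Function.update (Function.update w s(v, b) 0) s(v, b') 0) s(u, c) 1) s(u, a') 0) A j hc huc.symm one10
  have l11 := real_small_hub_eq_lonely_port (Function.update (Function.update (Function.update (Function.update w s(v, b) 0) s(v, b') 0) s(u, c) 1) s(u, a') 1) A j hc huc.symm one11
  have g10 := real_notConn_port_eq_zero (Function.update (Function.update (Function.update (Function.update w s(v, b) 1) s(v, b') 1) s(u, c) 1) s(u, a') 0) huc.symm one10' {ω : BondConfig (Fin n) | ω ∉ openConn c u ∧ ω ∉ openConn c v ∧ (A.filter fun z => ω ∈ openConn c z).card ≤ j} (fun ω hω => hω.1)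
  have g11 := real_notConn_port_eq_zero (Function.update (Function.update (Function.update (Function.update w s(v, b) 1) s(v, b') 1) s(u, c) 1) s(u, a') 1) huc.symm one11' {ω : BondConfig (Fin n) | ω ∉ openConn c u ∧ ω ∉ openConn c v ∧ (A.filter fun z => ω ∈ openConn c z).card ≤ j} (fun ω hω => hω.1)
  have k10 := real_notConn_port_eq_zero (Function.update (Function.update (Function.update (Function.update w s(v, b) 1) s(v, b') 1) s(u, c) 1) s(u, a') 0) huc.symm one10' {ω : BondConfig (Fin n) | ω ∉ openConn c u ∧ ω ∉ openConn c v ∧ 1 ≤ (A.filter fun z => ω ∈ openConn u z ∨ ω ∈ openConn v z).card ∧ (A.filter fun z => ω ∈ openConn u z ∨ ω ∈ openConn v z).card ≤ j} (fun ω hω => hω.1)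
  have k11 := real_notConn_port_eq_zero (Function.update (Function.update (Function.update (Function.update w s(v, b) 1) s(v, b') 1) s(u, c) 1) s(u, a') 1) huc.symm one11' {ω : BondConfig (Fin n) | ω ∉ openConn c u ∧ ω ∉ openConn c v ∧ 1 ≤ (A.filter fun z => ω ∈ openConn u z ∨ ω ∈ openConn v z).card ∧ (A.filter fun z => ω ∈ openConn u z ∨ ω ∈ openConn v z).card ≤ j} (fun ω hω => hω.1)
  rw [l10, l11, g10, g11, k10, k11]
  -- the remaining combination is `(1 - a_c)·X` with `(1 - a_c a')·X ≥ 0`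
  have key : ∀ X : ℝ, 0 ≤ (1 - (w s(u, c) : ℝ) * (w s(u, a') : ℝ)) * X → 0 ≤ (1 - (w s(u, c) : ℝ)) * X := by
    intro X hX
    by_cases hx : 0 ≤ X
    · exact mul_nonneg (sub_nonneg.2 hp1) hx
    · have hx' : X ≤ 0 := le_of_lt (not_le.1 hx)
      have : 0 ≤ (w s(u, c) : ℝ) * (1 - (w s(u, a') : ℝ)) * (-X) := mul_nonneg (mul_nonneg hp0 (sub_nonneg.2 hq1)) (neg_nonneg.2 hx')
      nlinarith [hX, this]
  have k := key _ hZ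
  nlinarith [k]

/-- **MS-STAR, champion at a port, level `j ≤ 2` (unconditional).**  Two two-port stars `u = {c, a'}`, `v = {b, b'}` glued onto
`A` (hubs outside `A` with no other open pair, `c, a', b, b' ∈ A` pairwise distinct), the champion `c` of the glued graph being a
port of `u`, and `j ≤ 2`: then `P(ℓ(u,v;c)) ≤ P(ρ(u,v;c))`, i.e. CS₂ holds for merging `u` and `v`.
[this file; memo TWO-PORT-PEELING.md §9] -/
theorem championStabilityPair_cport_levelTwo (w : Sym2 (Fin n) → unitInterval) (A : Finset (Fin n))
    (u v c a' b b' : Fin n) (j : ℕ) (hj : j ≤ 2) (hu : u ∉ A) (hv : v ∉ A) (huv : u ≠ v)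
    (hc : c ∈ A) (ha' : a' ∈ A) (hb : b ∈ A) (hb' : b' ∈ A)
    (hca' : c ≠ a') (hcb : c ≠ b) (hcb' : c ≠ b') (ha'b : a' ≠ b) (ha'b' : a' ≠ b') (hbb' : b ≠ b')
    (hutwo : ∀ y : Fin n, y ≠ u → y ≠ c → y ≠ a' → w s(u, y) = 0)
    (hvtwo : ∀ y : Fin n, y ≠ v → y ≠ b → y ≠ b' → w s(v, y) = 0)
    (hchamp : ∀ x ∈ A,
      (prodBernoulli w).real {ω : BondConfig (Fin n) | (A.filter fun z => ω ∈ openConn x z).card ≤ j} ≤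
        (prodBernoulli w).real {ω : BondConfig (Fin n) | (A.filter fun z => ω ∈ openConn c z).card ≤ j}) :
    (prodBernoulli w).real {ω : BondConfig (Fin n) | ω ∉ openConn c u ∧ ω ∉ openConn c v ∧ 1 ≤ (A.filter fun z => ω ∈ openConn u z ∨ ω ∈ openConn v z).card ∧ (A.filter fun z => ω ∈ openConn u z ∨ ω ∈ openConn v z).card ≤ j} ≤
      (prodBernoulli w).real {ω : BondConfig (Fin n) | ω ∉ openConn c u ∧ ω ∉ openConn c v ∧ (A.filter fun z => ω ∈ openConn c z).card ≤ j} :=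
  championStabilityPair_cport_of_Z w A u v c a' b b' j hu hv huv hc ha' hb hb' hca' hbb' hvtwo hchamp
    (cport_nonneg_levelTwo w A u v c a' b b' j hj hu hv huv hc ha' hb hb' hca' hcb hcb' ha'b ha'b' hbb' hutwo hvtwo
      (hchamp a' ha') (hchamp b hb) (hchamp b' hb'))

end TwoPortPeeling

end Summit.CriticalPhenomena.PercolationContinuityZ3.Theorems
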